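import Summits.AtomisticToContinuum.Crystallization.Theorems.FrustratedLawDichotomyStrainedPatchHomValueT2SoundY
import Summits.AtomisticToContinuum.Crystallization.Theorems.FrustratedLawDichotomyStrainedPatchHomValueT2Track

/-!
# (I1) part Z — THE GRAPH RESTRICTION of the joint value leaf (`…HomValueT2Track` §13; critic row 1674 (B) docket item 2 `valueLeafT2T_sound`, first half):
# the track matrix entries (`mem_aFI`), ★ the restricted gradient/Hessian tables `gradTrack` / `hessTrack` enclose the real restrictions
# `g̃_e = g_e + Σ_m A_me g_{6+m}`, `H̃_{ee'} = H_{ee'} + Σ_m (H_{e,6+m}A_{me'} + A_{me}H_{6+m,e'}) + Σ_{m,m'} A_{me}A_{m'e'}H_{6+m,6+m'}` (and vanish off the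
# `6 × 6` block), the zeroed widths `wfU`, ★ the GRAPH IDENTITIES (`δ_{6+m} = Σ_e A_me δ_e` ⟹ the linear and quadratic terms are those of the restricted
# tables in the six entry variables), the drift half-width `driftW`, and the unpacking of the track verdict `valueLeafT2T`
# (27623 `(H) HomFloor`, hcp half; decomp-a2c hand-1 g49).

No definitions; 0 sorry; standard axioms; no instances / notation / `#eval`.  `--supports stmt-AtomisticToContinuum-27623`.
-/

noncomputable section

namespace Summit.AtomisticToContinuum.Crystallization.Theorems.FrustratedLawDichotomyStrainedPatchHomValueT2Kit

open scoped BigOperators RealInnerProductSpace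
open Finset
open Literature.Analysis.ValidatedNumerics.Numerics
open Summit.AtomisticToContinuum.Crystallization.Theorems.ChargedEnergyGapNegative (E3)
open Summit.AtomisticToContinuum.Crystallization.Theorems.FrustratedLawDichotomyStrainedPatchHomEntryGram (cen rad)
open Summit.AtomisticToContinuum.Crystallization.Theorems.FrustratedLawDichotomyStrainedPatchHomEntryGramHcp (shufFI)
open Summit.AtomisticToContinuum.Crystallization.Theorems.FrustratedLawDichotomyStrainedPatchHomCurvCentreKit (boxE cenE cenX cenMap cenShuf)

/-! ## §1. The track matrix and the restricted tables -/

/-- `aFI aP m e ∋ A_me = aP m e / SC` (`m < 3`, `e < 6`). [formal bookkeeping] -/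
theorem mem_aFI (aP : Fin 3 → Fin 6 → ℤ) {m e : ℕ} (hm : m < 3) (he : e < 6) : FI.mem (((aP ⟨m, hm⟩ ⟨e, he⟩ : ℤ) : ℝ) / SC) (aFI aP m e) := by
  unfold aFI; rw [dif_pos hm, dif_pos he]; exact mem_thin _

/-- ★ **`gradTrack` encloses the restricted gradient** `g̃_e = g_e + Σ_{m<3} A_me g_{6+m}` (`e < 6`). [folklore chaining] -/
theorem mem_gradTrack (aP : Fin 3 → Fin 6 → ℤ) (g : Array FI) (G : ℕ → ℝ) (hG : ∀ k, k < 9 → FI.mem (G k) (g.getD k fi0)) {e : ℕ} (he : e < 6) :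
    FI.mem (G e + (((aP ⟨0, by norm_num⟩ ⟨e, he⟩ : ℤ) : ℝ) / SC * G 6 + ((aP ⟨1, by norm_num⟩ ⟨e, he⟩ : ℤ) : ℝ) / SC * G 7 +
      ((aP ⟨2, by norm_num⟩ ⟨e, he⟩ : ℤ) : ℝ) / SC * G 8)) ((gradTrack aP g).getD e fi0) := by
  unfold gradTrack
  rw [getD_ofFn_lt _ _ (by omega : e < 9)]
  simp only [if_pos he]
  have h := FI.mem_add (FI.mem_add (FI.mem_add (hG e (by omega)) (FI.mem_mul (mem_aFI aP (m := 0) (by norm_num) he) (hG 6 (by norm_num))))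
    (FI.mem_mul (mem_aFI aP (m := 1) (by norm_num) he) (hG 7 (by norm_num)))) (FI.mem_mul (mem_aFI aP (m := 2) (by norm_num) he) (hG 8 (by norm_num)))
  have e3 : G e + (((aP ⟨0, by norm_num⟩ ⟨e, he⟩ : ℤ) : ℝ) / SC * G 6 + ((aP ⟨1, by norm_num⟩ ⟨e, he⟩ : ℤ) : ℝ) / SC * G 7 +
      ((aP ⟨2, by norm_num⟩ ⟨e, he⟩ : ℤ) : ℝ) / SC * G 8) =
      G e + ((aP ⟨0, by norm_num⟩ ⟨e, he⟩ : ℤ) : ℝ) / SC * G 6 + ((aP ⟨1, by norm_num⟩ ⟨e, he⟩ : ℤ) : ℝ) / SC * G 7 +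
        ((aP ⟨2, by norm_num⟩ ⟨e, he⟩ : ℤ) : ℝ) / SC * G 8 := by ring
  rw [e3]
  simpa [List.range, List.range.loop, List.foldl] using h

/-- Off the six entry slots `gradTrack` is the zero interval. [formal bookkeeping] -/
theorem gradTrack_ge6 (aP : Fin 3 → Fin 6 → ℤ) (g : Array FI) {k : ℕ} (hk : 6 ≤ k) (hk9 : k < 9) : (gradTrack aP g).getD k fi0 = fi0 := by
  unfold gradTrack; rw [getD_ofFn_lt _ _ hk9]; simp only [if_neg (not_lt.2 hk)]

/-- ★ **`hessTrack` encloses the restricted Hessian** at an entry pair `e, e' < 6`. [folklore chaining] -/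
theorem mem_hessTrack (aP : Fin 3 → Fin 6 → ℤ) (H : Array FI) (h : ℕ → ℕ → ℝ) (hh : ∀ k l, k < 9 → l < 9 → FI.mem (h k l) (H.getD (9 * k + l) fi0))
    {e e' : ℕ} (he : e < 6) (he' : e' < 6) :
    FI.mem ((List.range 3).foldl (fun s m =>
        (List.range 3).foldl (fun s2 m' => s2 + (((aP ⟨m % 3, Nat.mod_lt _ (by norm_num)⟩ ⟨e, he⟩ : ℤ) : ℝ) / SC *
            (((aP ⟨m' % 3, Nat.mod_lt _ (by norm_num)⟩ ⟨e', he'⟩ : ℤ) : ℝ) / SC)) * h (6 + m) (6 + m'))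
          (s + h e (6 + m) * ((((aP ⟨m % 3, Nat.mod_lt _ (by norm_num)⟩ ⟨e', he'⟩ : ℤ) : ℝ) / SC)) +
            (((aP ⟨m % 3, Nat.mod_lt _ (by norm_num)⟩ ⟨e, he⟩ : ℤ) : ℝ) / SC) * h (6 + m) e')) (h e e'))
      ((hessTrack aP H).getD (9 * e + e') fi0) := by
  unfold hessTrack
  rw [getD_ofFn_lt _ _ (by omega : 9 * e + e' < 81)]
  have e1 : (9 * e + e') / 9 = e := by omega
  have e2 : (9 * e + e') % 9 = e' := by omega
  simp only [e1, e2, if_pos (And.intro he he')]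
  have hA : ∀ m : ℕ, m < 3 → ∀ (f : ℕ) (hf : f < 6), FI.mem (((aP ⟨m % 3, Nat.mod_lt _ (by norm_num)⟩ ⟨f, hf⟩ : ℤ) : ℝ) / SC) (aFI aP m f) := by
    intro m hm f hf
    have hmod : m % 3 = m := Nat.mod_eq_of_lt hm
    have key := mem_aFI aP hm hf
    convert key using 3
    exact congrArg₂ _ (Fin.ext hmod) rfl
  -- generic: real folds mirror interval folds
  have inner : ∀ (m : ℕ), m < 3 → ∀ (s : FI) (a : ℝ), FI.mem a s →
      FI.mem ((List.range 3).foldl (fun s2 m' => s2 + (((aP ⟨m % 3, Nat.mod_lt _ (by norm_num)⟩ ⟨e, he⟩ : ℤ) : ℝ) / SC *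
          (((aP ⟨m' % 3, Nat.mod_lt _ (by norm_num)⟩ ⟨e', he'⟩ : ℤ) : ℝ) / SC)) * h (6 + m) (6 + m')) a)
        ((List.range 3).foldl (fun s2 m' => s2.add (((aFI aP m e).mul (aFI aP m' e')).mul (H.getD (9 * (6 + m) + (6 + m')) fi0))) s) := by
    intro m hm s a ha
    have step : ∀ (L : List ℕ), (∀ m' ∈ L, m' < 3) → ∀ (s : FI) (a : ℝ), FI.mem a s →
        FI.mem (L.foldl (fun s2 m' => s2 + (((aP ⟨m % 3, Nat.mod_lt _ (by norm_num)⟩ ⟨e, he⟩ : ℤ) : ℝ) / SC *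
            (((aP ⟨m' % 3, Nat.mod_lt _ (by norm_num)⟩ ⟨e', he'⟩ : ℤ) : ℝ) / SC)) * h (6 + m) (6 + m')) a)
          (L.foldl (fun s2 m' => s2.add (((aFI aP m e).mul (aFI aP m' e')).mul (H.getD (9 * (6 + m) + (6 + m')) fi0))) s) := by
      intro L hL
      induction L with
      | nil => intro s a ha; simpa using ha
      | cons m' L ih =>
        intro s a ha
        simp only [List.foldl_cons]
        refine ih (fun x hx => hL x (List.mem_cons_of_mem _ hx)) _ _ ?_
        exact FI.mem_add ha (FI.mem_mul (FI.mem_mul (hA m hm e he) (hA m' (hL m' (by simp)) e' he')) (hh _ _ (by omega) (by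
          have := hL m' (by simp); omega)))
    exact step _ (fun m' hm' => by simpa using hm') s a ha
  have outer : ∀ (L : List ℕ), (∀ m ∈ L, m < 3) → ∀ (s : FI) (a : ℝ), FI.mem a s →
      FI.mem (L.foldl (fun s m =>
        (List.range 3).foldl (fun s2 m' => s2 + (((aP ⟨m % 3, Nat.mod_lt _ (by norm_num)⟩ ⟨e, he⟩ : ℤ) : ℝ) / SC *
            (((aP ⟨m' % 3, Nat.mod_lt _ (by norm_num)⟩ ⟨e', he'⟩ : ℤ) : ℝ) / SC)) * h (6 + m) (6 + m'))
          (s + h e (6 + m) * ((((aP ⟨m % 3, Nat.mod_lt _ (by norm_num)⟩ ⟨e', he'⟩ : ℤ) : ℝ) / SC)) +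
            (((aP ⟨m % 3, Nat.mod_lt _ (by norm_num)⟩ ⟨e, he⟩ : ℤ) : ℝ) / SC) * h (6 + m) e')) a)
        (L.foldl (fun s m =>
          (List.range 3).foldl (fun s2 m' => s2.add (((aFI aP m e).mul (aFI aP m' e')).mul (H.getD (9 * (6 + m) + (6 + m')) fi0)))
            ((s.add ((H.getD (9 * e + (6 + m)) fi0).mul (aFI aP m e'))).add ((aFI aP m e).mul (H.getD (9 * (6 + m) + e') fi0)))) s) := by
    intro L hL
    induction L with
    | nil => intro s a ha; simpa using ha
    | cons m L ih =>
      intro s a ha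
      simp only [List.foldl_cons]
      have hm : m < 3 := hL m (by simp)
      refine ih (fun x hx => hL x (List.mem_cons_of_mem _ hx)) _ _ ?_
      refine inner m hm _ _ ?_
      exact FI.mem_add (FI.mem_add ha (FI.mem_mul (hh _ _ (by omega) (by omega)) (hA m hm e' he'))) (FI.mem_mul (hA m hm e he) (hh _ _ (by omega) (by omega)))
  exact outer _ (fun m hm => by simpa using hm) _ _ (hh e e' (by omega) (by omega))

/-- Off the `6 × 6` block `hessTrack` is the zero interval. [formal bookkeeping] -/
theorem hessTrack_masked (aP : Fin 3 → Fin 6 → ℤ) (H : Array FI) {k l : ℕ} (hk : k < 9) (hl : l < 9) (hkl : 6 ≤ k ∨ 6 ≤ l) :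
    (hessTrack aP H).getD (9 * k + l) fi0 = fi0 := by
  unfold hessTrack
  rw [getD_ofFn_lt _ _ (by omega : 9 * k + l < 81)]
  have e1 : (9 * k + l) / 9 = k := by omega
  have e2 : (9 * k + l) % 9 = l := by omega
  simp only [e1, e2]
  rw [if_neg (by omega)]

/-- Reading `wfU`. [formal bookkeeping] -/
theorem wfU_getD (wf : Array ℤ) (k : ℕ) : (wfU wf).getD k 0 = if k < 6 then wf.getD k 0 else 0 := by
  unfold wfU
  by_cases hk : k < 9
  · rw [getD_ofFn_lt _ _ hk]
  · rw [getD_ofFn_ge _ _ (not_lt.1 hk), if_neg (by omega)]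

/-! ## §2. ★ The graph identities -/

/-- ★ **LINEAR GRAPH IDENTITY**: if `δ_{6+m} = Σ_{e<6} A_me δ_e` then `Σ_{k<9} G_k δ_k = Σ_{e<6} (G_e + Σ_m A_me G_{6+m}) δ_e`. [arithmetic] -/
theorem lin_graph (G δ : ℕ → ℝ) (A : ℕ → ℕ → ℝ) (hδ : ∀ m, m < 3 → δ (6 + m) = ∑ e ∈ range 6, A m e * δ e) :
    ∑ k ∈ range 9, G k * δ k = ∑ e ∈ range 6, (G e + (A 0 e * G 6 + A 1 e * G 7 + A 2 e * G 8)) * δ e := by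
  have h6 := hδ 0 (by norm_num); have h7 := hδ 1 (by norm_num); have h8 := hδ 2 (by norm_num)
  norm_num at h6 h7 h8
  simp only [Finset.sum_range_succ, Finset.sum_range_zero, zero_add] at h6 h7 h8 ⊢
  rw [h6, h7, h8]
  ring

/-- ★ **QUADRATIC GRAPH IDENTITY**: with `δ_{6+m} = Σ_e A_me δ_e`, `Σ_{k,l<9} h_kl δ_kδ_l` equals the six-variable form of the restricted Hessian (written
with the same folds as `mem_hessTrack`). [arithmetic] -/
theorem quad_graph (h : ℕ → ℕ → ℝ) (δ : ℕ → ℝ) (A : ℕ → ℕ → ℝ) (hδ : ∀ m, m < 3 → δ (6 + m) = ∑ e ∈ range 6, A m e * δ e) :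
    ∑ k ∈ range 9, ∑ l ∈ range 9, h k l * (δ k * δ l) =
      ∑ e ∈ range 6, ∑ e' ∈ range 6, ((List.range 3).foldl (fun s m =>
        (List.range 3).foldl (fun s2 m' => s2 + (A m e * A m' e') * h (6 + m) (6 + m')) (s + h e (6 + m) * A m e' + A m e * h (6 + m) e')) (h e e')) *
        (δ e * δ e') := by
  have h6 := hδ 0 (by norm_num); have h7 := hδ 1 (by norm_num); have h8 := hδ 2 (by norm_num)
  norm_num at h6 h7 h8
  simp only [List.range, List.range.loop, List.foldl]
  simp only [Finset.sum_range_succ, Finset.sum_range_zero, zero_add] at h6 h7 h8 ⊢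
  rw [h6, h7, h8]
  ring

end Summit.AtomisticToContinuum.Crystallization.Theorems.FrustratedLawDichotomyStrainedPatchHomValueT2Kit
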